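import Summits.ResolutionOfSingularities.ResolutionOfSingularities.Theorems.FrobeniusLadderFInjectiveMacaulayficationGoodOverUnivOfL4
import Summits.ResolutionOfSingularities.ResolutionOfSingularities.Theorems.FrobeniusLadderFInjectiveMacaulayficationAbsorbingStep
import Summits.ResolutionOfSingularities.ResolutionOfSingularities.Theorems.FrobeniusLadderFInjectiveMacaulayficationRelClosedSubsetFixFinite
import HarnessLib

/-!
# THE DIM-4 CORES OF DOOR v35 FROM (L4): `#4β` and FC″(loc dim ≤ 3) on FOURFOLDS, both from the universally FULL centre (GU)
# (crux `FInjectiveMacaulayfication` stmt-ResolutionOfSingularities-15315, chain w45a; res-L1-w45a-plan-1 RULING R17.1 (β)/(γ): the theorems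
# `closedCentreExistsDimEq4_of_L4` / `fcUnguardedLocDimLe3DimEq4_of_L4` that door v35 binds to; seat res-L1-w45a-stub-3 g7)

[OURS · L1 W4.5a] Support file (`--supports stmt-ResolutionOfSingularities-15315 --as helper`); NOT a statement of any manuscript; def-free — the
two targets are stated as the ∀-texts of `ClosedCentreRungs.ClosedCentreExistsDimGe4` and `FCUnguardedLocDimLe3.FCUnguardedLocDimLe3` with the
SINGLE substitution `4 ≤ topologicalKrullDim X₁` ↦ `topologicalKrullDim X₁ = 4` (= res-L1-w45a-stub-1's forthcoming `DimSplitFive.ClosedCentreExistsDimEq4`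
/ `FCUnguardedLocDimLe3DimEq4`, R17.1 (α); those defs unfold to these texts token for token). CONDITIONAL on {CP 2019 Thm. 1.1 (i)(ii),
Raynaud–Gruson 5.2.2, CP 2019 Prop. 4.4} BY NAME and on the chain's CANDIDATE (L4) `LocalFullificationDimFour.LocalFullificationDimFour`.
AI-written (AI review is weaker than expert review).

Both are immediate from (GU) `GoodOverUnivOfL4.exists_isBlowup_fullCentre_of_L4`: ONE centre `J ≠ ⊥` through every non-FULL point with ALL
blowings up FULL at EVERY point. `#4β(= 4)`: the bad closed point `b` is not FULL, hence in `Supp J`; the clause over `Supp J` is FULL unfolded.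
FC″(≤ 3)(= 4): the bad `η` lies in `Supp J`; the (A′) datum at `η` for any generating tuple `c′` of `J_η` by
`AbsorbingStep.locFixData_of_goodOver_nhd` with `U := ⊤` (GoodOver everywhere: FULL at non-closed points, FULL ⇒ CM-clause at closed points,
`RelClosedSubsetFixFinite.cmCl_of_fullCl`); the (nc)/(cl) clauses likewise. The Cohen–Macaulay and finiteness binders of the targets are not used.
[folklore assembly] [cite: StacksProject, Tag 0804; Tag 085U] [cite: Temkin2008, Prop. 2.3.4] [cite: CossartPiltant2019, Thm. 1.1 (i)(ii); Prop. 4.4]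
-/

-- single-problem summit: the doubled namespace component is forced
set_option linter.dupNamespace false

noncomputable section

namespace Summit.ResolutionOfSingularities.ResolutionOfSingularities.Theorems.FInjectiveMacaulayfication.DimFourCoresOfL4

open CategoryTheory CategoryTheory.Limits AlgebraicGeometry TopologicalSpace IsLocalRing
open Literature.AlgebraicGeometry.Resolution
open Summit.ResolutionOfSingularities.ResolutionOfSingularities.Theorems.FInjectiveMacaulayfication
open SliceableCentre FCUnguardedAprime

/-! ## §1 `#4β` on fourfolds from (L4) -/

/-- **`#4β` on FOURFOLDS ⟸ (L4)** — the ∀-text of `ClosedCentreRungs.ClosedCentreExistsDimGe4` with `topologicalKrullDim X₁ = 4` in place of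
`4 ≤ topologicalKrullDim X₁` (= `DimSplitFive.ClosedCentreExistsDimEq4` unfolded). [OURS · conditional-result]
[cite: StacksProject, Tag 085U] [cite: Temkin2008, Prop. 2.3.4] [cite: CossartPiltant2019, Thm. 1.1 (i)(ii); Prop. 4.4] -/
theorem closedCentreExistsDimEq4_of_L4
    (hG : CossartPiltant2019General.{0}) (h081R : Stacks081R.{0}) (hP : CossartPiltant2019Principalization.{0})
    (hL4 : LocalFullificationDimFour.LocalFullificationDimFour) :
    ∀ (p : ℕ), p.Prime → ∀ (k : Type) [Field k] [CharP k p] (X₁ : Scheme.{0}) (f₁ : X₁ ⟶ Spec (.of k)),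
    IsSeparated f₁ → LocallyOfFiniteType f₁ → QuasiCompact f₁ → IsIntegral X₁ → topologicalKrullDim X₁ = 4 →
    (∀ x : X₁, ∀ d : ℕ, ringKrullDim (X₁.presheaf.stalk x) = d → ∀ s : Fin d → X₁.presheaf.stalk x, (Ideal.span (Set.range s)).radical.IsMaximal → RingTheory.Sequence.IsWeaklyRegular (X₁.presheaf.stalk x) (List.ofFn s)) →
    Set.Finite {x : X₁ | ¬ ∀ d : ℕ, ringKrullDim (X₁.presheaf.stalk x) = d → ∀ s : Fin d → X₁.presheaf.stalk x, (Ideal.span (Set.range s)).radical.IsMaximal → ∀ y : X₁.presheaf.stalk x, (∃ e : ℕ, y ^ p ^ e ∈ Ideal.span ((fun z : X₁.presheaf.stalk x => z ^ p ^ e) '' (Ideal.span (Set.range s) : Set (X₁.presheaf.stalk x)))) → y ∈ Ideal.span (Set.range s)} →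
    ∀ b : X₁, IsClosed ({b} : Set X₁) → (¬ ∀ d : ℕ, ringKrullDim (X₁.presheaf.stalk b) = d → ∀ s : Fin d → X₁.presheaf.stalk b, (Ideal.span (Set.range s)).radical.IsMaximal → ∀ y : X₁.presheaf.stalk b, (∃ e : ℕ, y ^ p ^ e ∈ Ideal.span ((fun z : X₁.presheaf.stalk b => z ^ p ^ e) '' (Ideal.span (Set.range s) : Set (X₁.presheaf.stalk b)))) → y ∈ Ideal.span (Set.range s)) →
      ∃ J : X₁.IdealSheafData, J ≠ ⊥ ∧ b ∈ (J.support : Set X₁) ∧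
        ∀ (X' : Scheme.{0}) (π : X' ⟶ X₁), Literature.AlgebraicGeometry.Resolution.IsBlowup π J →
          ∀ x' : X', π.base x' ∈ (J.support : Set X₁) → IsDomain (X'.presheaf.stalk x') ∧ ∀ d : ℕ, ringKrullDim (X'.presheaf.stalk x') = d → ∀ s : Fin d → X'.presheaf.stalk x', (Ideal.span (Set.range s)).radical.IsMaximal → RingTheory.Sequence.IsWeaklyRegular (X'.presheaf.stalk x') (List.ofFn s) ∧ ∀ y : X'.presheaf.stalk x', (∃ e : ℕ, y ^ p ^ e ∈ Ideal.span ((fun z : X'.presheaf.stalk x' => z ^ p ^ e) '' (Ideal.span (Set.range s) : Set (X'.presheaf.stalk x')))) → y ∈ Ideal.span (Set.range s) := by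
  intro p hp k _ _ X₁ f₁ hs hl hq hi h4 _ _ b _ hb
  haveI := hs
  haveI := hl
  haveI := hq
  haveI := hi
  obtain ⟨J, hJne, -, hbad, hfull⟩ := GoodOverUnivOfL4.exists_isBlowup_fullCentre_of_L4 hG h081R hP hL4 p hp k X₁ f₁ h4
  refine ⟨J, hJne, hbad b fun hF => hb fun d hd s hs => (hF.2 d hd s hs).2, fun X' π hπ x' _ => hfull X' π hπ x'⟩

/-! ## §2 FC″(loc dim ≤ 3) on fourfolds from (L4) -/

/-- **FC″(loc dim ≤ 3) on FOURFOLDS ⟸ (L4)** — the ∀-text of `FCUnguardedLocDimLe3.FCUnguardedLocDimLe3` with `topologicalKrullDim X₁ = 4` in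
place of `4 ≤ topologicalKrullDim X₁` (= `DimSplitFive.FCUnguardedLocDimLe3DimEq4` unfolded). [OURS · conditional-result]
[cite: StacksProject, Tag 0804; Tag 085U] [cite: Temkin2008, Prop. 2.3.4] [cite: CossartPiltant2019, Thm. 1.1 (i)(ii); Prop. 4.4] -/
theorem fcUnguardedLocDimLe3DimEq4_of_L4
    (hG : CossartPiltant2019General.{0}) (h081R : Stacks081R.{0}) (hP : CossartPiltant2019Principalization.{0})
    (hL4 : LocalFullificationDimFour.LocalFullificationDimFour) :
  ∀ (p : ℕ), p.Prime → ∀ (k : Type) [Field k] [CharP k p]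
    (X₁ : Scheme.{0}) (f₁ : X₁ ⟶ Spec (.of k)),
      IsSeparated f₁ → LocallyOfFiniteType f₁ → QuasiCompact f₁ → IsIntegral X₁ → topologicalKrullDim X₁ = 4 →
      (∀ x : X₁, (∀ d : ℕ, ringKrullDim (X₁.presheaf.stalk x) = d → ∀ s : Fin d → X₁.presheaf.stalk x,
        (Ideal.span (Set.range s)).radical.IsMaximal → RingTheory.Sequence.IsWeaklyRegular (X₁.presheaf.stalk x) (List.ofFn s))) →
      ∀ η : X₁, (¬ IsClosed ({η} : Set X₁) ∧ ¬ (∀ d : ℕ, ringKrullDim (X₁.presheaf.stalk η) = d → ∀ s : Fin d → X₁.presheaf.stalk η,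
          (Ideal.span (Set.range s)).radical.IsMaximal → ∀ t : X₁.presheaf.stalk η, (∃ e : ℕ, t ^ p ^ e ∈
            Ideal.span ((fun z : X₁.presheaf.stalk η => z ^ p ^ e) '' (Ideal.span (Set.range s) : Set (X₁.presheaf.stalk η)))) →
              t ∈ Ideal.span (Set.range s)) ∧
        ∀ y : X₁, y ⤳ η → y ≠ η → (∀ d : ℕ, ringKrullDim (X₁.presheaf.stalk y) = d → ∀ s : Fin d → X₁.presheaf.stalk y,
          (Ideal.span (Set.range s)).radical.IsMaximal → ∀ t : X₁.presheaf.stalk y, (∃ e : ℕ, t ^ p ^ e ∈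
            Ideal.span ((fun z : X₁.presheaf.stalk y => z ^ p ^ e) '' (Ideal.span (Set.range s) : Set (X₁.presheaf.stalk y)))) →
              t ∈ Ideal.span (Set.range s))) →
      ringKrullDim (X₁.presheaf.stalk η) ≤ 3 →
      ∃ (J : X₁.IdealSheafData) (n' : ℕ) (c' : Fin n' → X₁.presheaf.stalk η), J ≠ ⊥ ∧ η ∈ (J.support : Set X₁) ∧
      Ideal.span (Set.range c') ≠ ⊥ ∧ Ideal.span (Set.range c') ≤ maximalIdeal (X₁.presheaf.stalk η) ∧
        (∀ (j : Fin n') (𝔔 : PrimeSpectrum (blowupAlgebra (Ideal.span (Set.range c')) (c' j))),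
          𝔔.asIdeal.comap (algebraMap (X₁.presheaf.stalk η) (blowupAlgebra (Ideal.span (Set.range c')) (c' j))) =
            maximalIdeal (X₁.presheaf.stalk η) →
          IsDomain (Localization.AtPrime 𝔔.asIdeal) ∧ ∀ d : ℕ, ringKrullDim (Localization.AtPrime 𝔔.asIdeal) = d →
            ∀ s : Fin d → Localization.AtPrime 𝔔.asIdeal, (Ideal.span (Set.range s)).radical.IsMaximal →
              RingTheory.Sequence.IsWeaklyRegular (Localization.AtPrime 𝔔.asIdeal) (List.ofFn s) ∧
              ∀ y : Localization.AtPrime 𝔔.asIdeal, (∃ e : ℕ, y ^ p ^ e ∈ Ideal.span ((fun z : Localization.AtPrime 𝔔.asIdeal => z ^ p ^ e) ''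
                (Ideal.span (Set.range s) : Set (Localization.AtPrime 𝔔.asIdeal)))) → y ∈ Ideal.span (Set.range s)) ∧
      stalkIdeal J η = Ideal.span (Set.range c') ∧
      (∀ (X₂ : Scheme.{0}) (π : X₂ ⟶ X₁), IsBlowup π J →
        (∀ x : X₂, π.base x ∈ (J.support : Set X₁) → π.base x ≠ η → ¬ IsClosed ({x} : Set X₂) →
          IsDomain (X₂.presheaf.stalk x) ∧ ∀ d : ℕ, ringKrullDim (X₂.presheaf.stalk x) = d → ∀ s : Fin d → X₂.presheaf.stalk x,
            (Ideal.span (Set.range s)).radical.IsMaximal → RingTheory.Sequence.IsWeaklyRegular (X₂.presheaf.stalk x) (List.ofFn s) ∧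
            ∀ t : X₂.presheaf.stalk x, (∃ e : ℕ, t ^ p ^ e ∈ Ideal.span ((fun z : X₂.presheaf.stalk x => z ^ p ^ e) ''
              (Ideal.span (Set.range s) : Set (X₂.presheaf.stalk x)))) → t ∈ Ideal.span (Set.range s)) ∧
        (∀ x : X₂, π.base x ∈ (J.support : Set X₁) → IsClosed ({x} : Set X₂) →
          ∀ d : ℕ, ringKrullDim (X₂.presheaf.stalk x) = d → ∀ s : Fin d → X₂.presheaf.stalk x,
            (Ideal.span (Set.range s)).radical.IsMaximal → RingTheory.Sequence.IsWeaklyRegular (X₂.presheaf.stalk x) (List.ofFn s))) := by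
  intro p hp k _ _ X₁ f₁ hs hl hq hi h4 _ η hη _
  haveI := hs
  haveI := hl
  haveI := hq
  haveI := hi
  haveI : IsLocallyNoetherian X₁ := LocallyOfFiniteType.isLocallyNoetherian f₁
  obtain ⟨J, hJne, -, hbad, hfull⟩ := GoodOverUnivOfL4.exists_isBlowup_fullCentre_of_L4 hG h081R hP hL4 p hp k X₁ f₁ h4
  -- `η ∈ Supp J`: `η` is not FULL
  have hηJ : η ∈ (J.support : Set X₁) := hbad η fun hF => hη.2.1 fun d hd s hs => (hF.2 d hd s hs).2
  -- GoodOver EVERYWHERE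
  have hgood : GoodOver p X₁ J ((⊤ : X₁.Opens) : Set X₁) := fun X₂ π hπ =>
    ⟨fun x _ _ => hfull X₂ π hπ x, fun x _ _ => RelClosedSubsetFixFinite.cmCl_of_fullCl (hfull X₂ π hπ x)⟩
  -- the (A′) datum at `η` for a generating tuple of `J_η`
  obtain ⟨n', c', hc⟩ := Submodule.fg_iff_exists_fin_generating_family.mp (IsNoetherian.noetherian (stalkIdeal J η))
  have hc' : Ideal.span (Set.range c') = stalkIdeal J η := hc
  have hdat : LocFixData p X₁ η n' c' :=
    AbsorbingStep.locFixData_of_goodOver_nhd p (U := ⊤) (Set.mem_univ η) hη.1 hJne hηJ hgood c' hc'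
  refine ⟨J, n', c', hJne, hηJ, hdat.1, hdat.2.1, fun j 𝔔 h𝔔 => hdat.2.2 j 𝔔 h𝔔, hc'.symm, fun X₂ π hπ => ⟨?_, ?_⟩⟩
  · intro x _ _ _
    exact hfull X₂ π hπ x
  · intro x _ _
    exact RelClosedSubsetFixFinite.cmCl_of_fullCl (hfull X₂ π hπ x)

end Summit.ResolutionOfSingularities.ResolutionOfSingularities.Theorems.FInjectiveMacaulayfication.DimFourCoresOfL4

end
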